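import Literature.NumberTheory.Automorphic.UnitaryGroupOrbitalMeasureOfLocal
import HarnessLib

/-!
# The adelic orbital measure FAMILY of `U(H)` built from LOCAL CLASS-INDEXED families: `AdelicOrbitalMeasureFamily.ofLocal (mG ·) mGi`,
# with `Φ([γ], f_∞ ⊗ ⊗_v f_v) = Φ_∞([γ_∞], f_∞) · ∏_v Φ_v([γ_v], f_v)` EXACTLY (Rogawski (1990) §5.4 pp. 71–72)

Topic `NumberTheory/Automorphic`; namespaces `Literature.NumberTheory.Automorphic` (§1, generic) and `….UnitaryGroup` (§2). Definitions (with
bodies) and theorems; no instance, no named fact, no `sorry`.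

The local transfer relations of a comparison of trace formulas are stated for CLASS-indexed local orbital measure families
`mG v : OrbitalMeasureFamily (U(H)(L⁺_v))` (measure on `G_v ⧸ C(out c)` at the representative `out c` of each class, ★ `OrbitalMeasureFamily`,
`classOrbitalIntegral`), and the geometric side of the trace formula for ★ `AdelicOrbitalMeasureFamily L N H` (measures on
`U(H)(𝔸) ⧸ C(γ)` at the diagonal images `γ = toAdelic (out [γ])` of the RATIONAL classes).  This file keys one to the other with NO constants:

* §1 `OrbitalMeasureFamily.atPoint m γ` — the measure of the class of `γ` TRANSPORTED to `G ⧸ C(γ)` along conjugation by a chosen `q` with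
  `q (out [γ]) q⁻¹ = γ` (`conjOut γ`, ★ `cosetCongr`); for invariant `m [γ]` it does not depend on the choice and
  **`orbitalIntegral γ f (m.atPoint γ) = classOrbitalIntegral m f [γ]`** (`OrbitalMeasureFamily.orbitalIntegral_atPoint`, ★ `orbitalIntegral_conj_eq`);
  admissibility transports (`smulInvariantMeasure_atPoint`, `isFiniteMeasureOnCompacts_atPoint`, `atPoint_ne_zero`).
* §2 `UnitaryGroup.IsNormalisedOff L N H mG g S₀` — «`(mG v).atPoint g_v (π U(H)(𝒪_v)) = 1` for `v ∉ S₀`» (the a.a.-`v` normalisation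
  `vol(K_v) = vol(T(𝒪_v)) = 1` of [Rogawski1990, §4.3 p. 44], read at `g`); **`AdelicOrbitalMeasureFamily.ofLocal L N H mG mGi`** — at a rational
  class `c`, ★ `adelicOrbitalMeasureOfLocal` at `γ = toAdelic (out c)` of `mGi.atPoint γ_∞` and the `(mG v).atPoint γ_v` (any exceptional set off
  which the family is normalised at `γ`; `0` if there is none — junk); `ofLocal_eq` (it IS that construction for every admissible normalising
  `S₀`), `ofLocal_admissible` (invariant, finite on compacta, `≠ 0`), and the headline
  **`adelicClassOrbitalIntegral_ofLocal_eval_eq_mul_prod`**: for a pure tensor `T` with integral levels off `T.S`, whose orbital integrand at `γ`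
  is integrable, and whose local CLASS orbital integrals `classOrbitalIntegral (mG v) (T.loc v) [γ_v]` are `1` off a finite `S₂`:
  `adelicClassOrbitalIntegral (ofLocal mG mGi) T.eval c = classOrbitalIntegral mGi T.arch [γ_∞] · ∏_{v∈S₂} classOrbitalIntegral (mG v) (T.loc v) [γ_v]`
  — the currency in which a J-side keyed to `ofLocal` meets place-by-place transfer relations (referee watch-list W7∕Δ13, W8-shape).
NOT here: the arithmetic «unramified» statement `{y : y γ_v y⁻¹ ∈ K_v} = K_v · C(γ_v)` for a.a. `v` ([Kottwitz1986, Prop. 7.1]) that turns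
`IsNormalisedOff` into a statement about `classOrbitalIntegral (mG v) 1_{K_v} [γ_v]` and makes the local factors eventually `1`.

## References
* J. D. Rogawski, *Automorphic Representations of Unitary Groups in Three Variables* (1990), §4.3 p. 44, §5.4 pp. 71–72 [Rogawski1990].
* S. Gelbart, *Automorphic forms on adele groups*, Ann. of Math. Stud. 83 (1975), (9.13), p. 155 (10.19) [Gelbart1975].
-/

noncomputable section

open MeasureTheory Measure Set Filter Topology NumberField IsDedekindDomain
open Literature.MeasureTheory.Group
open scoped ENNReal NNReal

namespace Literature.NumberTheory.Automorphic

/-! ## §1 A class-indexed orbital measure family read AT A POINT of the class -/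

section AtPoint

variable {G : Type*} [Group G]

/-- Some `q` conjugates the chosen representative of the class of `γ` to `γ`. [cite: Gelbart1975, (9.13)] -/
theorem exists_conj_out_conjClassesMk_eq (γ : G) : ∃ q : G, q * Quotient.out (ConjClasses.mk γ) * q⁻¹ = γ :=
  isConj_iff.1 (ConjClasses.mk_eq_mk_iff_isConj.1 (Quotient.out_eq (ConjClasses.mk γ)))

/-- **A conjugator** `conjOut γ` with `conjOut γ · out [γ] · (conjOut γ)⁻¹ = γ` (choice). [cite: Gelbart1975, (9.13)] -/
def conjOut (γ : G) : G := Classical.choose (exists_conj_out_conjClassesMk_eq γ)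

/-- `conj (conjOut γ) (out [γ]) = γ`. [cite: Gelbart1975, (9.13)] -/
theorem conj_conjOut_out (γ : G) : MulAut.conj (conjOut γ) (Quotient.out (ConjClasses.mk γ)) = γ :=
  Classical.choose_spec (exists_conj_out_conjClassesMk_eq γ)

variable [∀ γ : G, MeasurableSpace (G ⧸ Subgroup.centralizer ({γ} : Set G))]

/-- **The measure of a class-indexed orbital measure family AT A POINT `γ`**: `m [γ]` (on `G ⧸ C(out [γ])`) transported to `G ⧸ C(γ)` along
`cosetCongr (conj (conjOut γ))`. [cite: Gelbart1975, (9.13)] -/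
def OrbitalMeasureFamily.atPoint (m : OrbitalMeasureFamily G) (γ : G) : Measure (G ⧸ Subgroup.centralizer ({γ} : Set G)) :=
  (m (ConjClasses.mk γ)).map (cosetCongr (MulAut.conj (conjOut γ)) _ (Subgroup.centralizer ({γ} : Set G))
    (forall_apply_mem_centralizer_singleton_iff_of_eq (MulAut.conj (conjOut γ)) (conj_conjOut_out γ)))

variable [TopologicalSpace G] [IsTopologicalGroup G] [∀ γ : G, BorelSpace (G ⧸ Subgroup.centralizer ({γ} : Set G))]
  (m : OrbitalMeasureFamily G) (γ : G)

omit [∀ γ : G, MeasurableSpace (G ⧸ Subgroup.centralizer ({γ} : Set G))] [∀ γ : G, BorelSpace (G ⧸ Subgroup.centralizer ({γ} : Set G))] in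
/-- Conjugation is a homeomorphism: `conj q` is continuous. [cite: Gelbart1975, (9.13)] -/
theorem continuous_mulAutConj (q : G) : Continuous (MulAut.conj q : G ≃* G) := IsTopologicalGroup.continuous_conj q

omit [∀ γ : G, MeasurableSpace (G ⧸ Subgroup.centralizer ({γ} : Set G))] [∀ γ : G, BorelSpace (G ⧸ Subgroup.centralizer ({γ} : Set G))] in
/-- `(conj q)⁻¹` is continuous. [cite: Gelbart1975, (9.13)] -/
theorem continuous_mulAutConj_symm (q : G) : Continuous (MulAut.conj q : G ≃* G).symm := by
  change Continuous fun h => q⁻¹ * h * q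
  exact (continuous_mul_const q).comp (continuous_const_mul q⁻¹)

/-- **The orbital integral at `γ` against `m.atPoint γ` IS the class orbital integral at `[γ]`** (invariant `m [γ]`): exact change of variables
along `cosetCongr (conj q)` and conjugation invariance ★ `orbitalIntegral_conj_eq`. [cite: Gelbart1975, (9.13)] [cite: Rogawski1990, §4.9 p. 54] -/
theorem OrbitalMeasureFamily.orbitalIntegral_atPoint
    [SMulInvariantMeasure G (G ⧸ Subgroup.centralizer ({(Quotient.out (ConjClasses.mk γ) : G)} : Set G)) (m (ConjClasses.mk γ))]
    (f : G → ℂ) : orbitalIntegral γ f (m.atPoint γ) = classOrbitalIntegral m f (ConjClasses.mk γ) := by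
  rw [classOrbitalIntegral_eq, OrbitalMeasureFamily.atPoint, orbitalIntegral_eq_integral_descConj,
    integral_descConj_map_cosetCongr (MulAut.conj (conjOut γ)) (continuous_mulAutConj _) (continuous_mulAutConj_symm _)
      (conj_conjOut_out γ) _ f, ← orbitalIntegral_eq_integral_descConj]
  exact orbitalIntegral_conj_eq _ _ (conjOut γ) f

/-- `m.atPoint γ` is invariant when `m [γ]` is. [cite: Gelbart1975, (9.13)] -/
theorem OrbitalMeasureFamily.smulInvariantMeasure_atPoint
    [SMulInvariantMeasure G (G ⧸ Subgroup.centralizer ({(Quotient.out (ConjClasses.mk γ) : G)} : Set G)) (m (ConjClasses.mk γ))] :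
    SMulInvariantMeasure G (G ⧸ Subgroup.centralizer ({γ} : Set G)) (m.atPoint γ) :=
  smulInvariantMeasure_map_cosetCongr_of_smulInvariant (MulAut.conj (conjOut γ)) (continuous_mulAutConj _) _ _ _ _

/-- `m.atPoint γ` is finite on compacta when `m [γ]` is. [cite: Gelbart1975, (9.13)] -/
theorem OrbitalMeasureFamily.isFiniteMeasureOnCompacts_atPoint [IsFiniteMeasureOnCompacts (m (ConjClasses.mk γ))] :
    IsFiniteMeasureOnCompacts (m.atPoint γ) :=
  isFiniteMeasureOnCompacts_map_cosetCongr (MulAut.conj (conjOut γ)) (continuous_mulAutConj _) (continuous_mulAutConj_symm _)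
    (conj_conjOut_out γ) _

/-- `m.atPoint γ ≠ 0` when `m [γ] ≠ 0`. [cite: Gelbart1975, (9.13)] -/
theorem OrbitalMeasureFamily.atPoint_ne_zero (h : m (ConjClasses.mk γ) ≠ 0) : m.atPoint γ ≠ 0 :=
  map_cosetCongr_ne_zero (MulAut.conj (conjOut γ)) (continuous_mulAutConj _) (conj_conjOut_out γ) _ h

end AtPoint

/-! ## §2 `AdelicOrbitalMeasureFamily.ofLocal` and its exact Euler product -/

namespace UnitaryGroup

variable (L : Type) [Field L] [NumberField L] [IsCMField L] (N : ℕ) (H : Matrix (Fin N) (Fin N) L)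
  [∀ g : (cmDatum L N H).Adelic, MeasurableSpace ((cmDatum L N H).Adelic ⧸ Subgroup.centralizer ({g} : Set (cmDatum L N H).Adelic))]
  [∀ a : arch (↥(maximalRealSubfield L)) L (IsCMField.complexConj L) N H,
    MeasurableSpace (arch (↥(maximalRealSubfield L)) L (IsCMField.complexConj L) N H ⧸
      Subgroup.centralizer ({a} : Set (arch (↥(maximalRealSubfield L)) L (IsCMField.complexConj L) N H)))]
  [∀ (v : HeightOneSpectrum (𝓞 ↥(maximalRealSubfield L))) (x : (cmDatum L N H).Local v),
    MeasurableSpace ((cmDatum L N H).Local v ⧸ Subgroup.centralizer ({x} : Set ((cmDatum L N H).Local v)))]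
  (mG : ∀ v : HeightOneSpectrum (𝓞 ↥(maximalRealSubfield L)), OrbitalMeasureFamily ((cmDatum L N H).Local v))
  (mGi : OrbitalMeasureFamily (arch (↥(maximalRealSubfield L)) L (IsCMField.complexConj L) N H))

/-- **The local family is normalised at `g` off `S₀`**: `(mG v).atPoint g_v (π U(H)(𝒪_v)) = 1` for `v ∉ S₀` (`g_v = toLocal v g`).
[cite: Rogawski1990, §4.3 p. 44] -/
def IsNormalisedOff (g : (cmDatum L N H).Adelic) (S₀ : Finset (HeightOneSpectrum (𝓞 ↥(maximalRealSubfield L)))) : Prop :=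
  ∀ v, v ∉ S₀ → (mG v).atPoint ((cmDatum L N H).toLocal v g)
    ((QuotientGroup.mk : (cmDatum L N H).Local v → _) '' (cmLocalIntegralLevel L N H v : Set ((cmDatum L N H).Local v))) = 1

/-- **The adelic orbital measure family BUILT FROM LOCAL CLASS-INDEXED FAMILIES**: at a rational class `c` with `γ = toAdelic (out c)`, the measure
★ `adelicOrbitalMeasureOfLocal L N H γ (mGi.atPoint γ_∞) (v ↦ (mG v).atPoint γ_v) S₀` for a (chosen) exceptional finite set `S₀` off which the
family is normalised at `γ` — independent of that choice (`ofLocal_eq`) — and `0` if there is none (junk); the finite-adelic orbit space carries its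
Borel σ-algebra. [cite: Rogawski1990, §5.4 p. 72] -/
def AdelicOrbitalMeasureFamily.ofLocal : AdelicOrbitalMeasureFamily L N H := fun c =>
  letI : MeasurableSpace (finAdelic (↥(maximalRealSubfield L)) L (IsCMField.complexConj L) N H ⧸
      Subgroup.centralizer ({finPart (↥(maximalRealSubfield L)) L (IsCMField.complexConj L) N H ((cmDatum L N H).toAdelic (Quotient.out c))} :
        Set (finAdelic (↥(maximalRealSubfield L)) L (IsCMField.complexConj L) N H))) := borel _
  @dite _ (∃ S₀, IsNormalisedOff L N H mG ((cmDatum L N H).toAdelic (Quotient.out c)) S₀) (Classical.dec _)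
    (fun h => adelicOrbitalMeasureOfLocal L N H ((cmDatum L N H).toAdelic (Quotient.out c))
      (mGi.atPoint (archPart (↥(maximalRealSubfield L)) L (IsCMField.complexConj L) N H ((cmDatum L N H).toAdelic (Quotient.out c))))
      (fun v => (mG v).atPoint ((cmDatum L N H).toLocal v ((cmDatum L N H).toAdelic (Quotient.out c)))) h.choose)
    (fun _ => 0)

variable [∀ (v : HeightOneSpectrum (𝓞 ↥(maximalRealSubfield L))) (x : (cmDatum L N H).Local v),
    BorelSpace ((cmDatum L N H).Local v ⧸ Subgroup.centralizer ({x} : Set ((cmDatum L N H).Local v)))]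
  (c : ConjClasses (cmDatum L N H).Rational)

/-- **`ofLocal` IS the construction for EVERY admissible normalising exceptional set**: if the local family is admissible at the classes
`[γ_v]` (`γ = toAdelic (out c)`) and normalised at `γ` off `S₀`, then `ofLocal mG mGi c = adelicOrbitalMeasureOfLocal γ (mGi.atPoint γ_∞)
(v ↦ (mG v).atPoint γ_v) S₀` (★ independence of the exceptional set). [cite: Rogawski1990, §5.4 p. 72] -/
theorem AdelicOrbitalMeasureFamily.ofLocal_eq {S₀ : Finset (HeightOneSpectrum (𝓞 ↥(maximalRealSubfield L)))}
    (hS₀ : IsNormalisedOff L N H mG ((cmDatum L N H).toAdelic (Quotient.out c)) S₀)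
    (hadm : ∀ v, mG v (ConjClasses.mk ((cmDatum L N H).toLocal v ((cmDatum L N H).toAdelic (Quotient.out c)))) ≠ 0 ∧
      SMulInvariantMeasure ((cmDatum L N H).Local v) _ (mG v (ConjClasses.mk ((cmDatum L N H).toLocal v ((cmDatum L N H).toAdelic (Quotient.out c))))) ∧
      IsFiniteMeasureOnCompacts (mG v (ConjClasses.mk ((cmDatum L N H).toLocal v ((cmDatum L N H).toAdelic (Quotient.out c)))))) :
    AdelicOrbitalMeasureFamily.ofLocal L N H mG mGi c =
      (letI : MeasurableSpace (finAdelic (↥(maximalRealSubfield L)) L (IsCMField.complexConj L) N H ⧸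
          Subgroup.centralizer ({finPart (↥(maximalRealSubfield L)) L (IsCMField.complexConj L) N H ((cmDatum L N H).toAdelic (Quotient.out c))} :
            Set (finAdelic (↥(maximalRealSubfield L)) L (IsCMField.complexConj L) N H))) := borel _;
        adelicOrbitalMeasureOfLocal L N H ((cmDatum L N H).toAdelic (Quotient.out c))
          (mGi.atPoint (archPart (↥(maximalRealSubfield L)) L (IsCMField.complexConj L) N H ((cmDatum L N H).toAdelic (Quotient.out c))))
          (fun v => (mG v).atPoint ((cmDatum L N H).toLocal v ((cmDatum L N H).toAdelic (Quotient.out c)))) S₀) := by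
  classical
  letI : MeasurableSpace (finAdelic (↥(maximalRealSubfield L)) L (IsCMField.complexConj L) N H ⧸
      Subgroup.centralizer ({finPart (↥(maximalRealSubfield L)) L (IsCMField.complexConj L) N H ((cmDatum L N H).toAdelic (Quotient.out c))} :
        Set (finAdelic (↥(maximalRealSubfield L)) L (IsCMField.complexConj L) N H))) := borel _
  haveI : BorelSpace (finAdelic (↥(maximalRealSubfield L)) L (IsCMField.complexConj L) N H ⧸
      Subgroup.centralizer ({finPart (↥(maximalRealSubfield L)) L (IsCMField.complexConj L) N H ((cmDatum L N H).toAdelic (Quotient.out c))} :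
        Set (finAdelic (↥(maximalRealSubfield L)) L (IsCMField.complexConj L) N H))) := ⟨rfl⟩
  haveI : ∀ v, SMulInvariantMeasure ((cmDatum L N H).Local v) _ (mG v (ConjClasses.mk ((cmDatum L N H).toLocal v ((cmDatum L N H).toAdelic (Quotient.out c))))) := fun v => (hadm v).2.1
  haveI : ∀ v, IsFiniteMeasureOnCompacts (mG v (ConjClasses.mk ((cmDatum L N H).toLocal v ((cmDatum L N H).toAdelic (Quotient.out c))))) := fun v => (hadm v).2.2
  haveI : ∀ v, SMulInvariantMeasure ((cmDatum L N H).Local v) _ ((mG v).atPoint ((cmDatum L N H).toLocal v ((cmDatum L N H).toAdelic (Quotient.out c)))) :=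
    fun v => (mG v).smulInvariantMeasure_atPoint _
  haveI : ∀ v, IsFiniteMeasureOnCompacts ((mG v).atPoint ((cmDatum L N H).toLocal v ((cmDatum L N H).toAdelic (Quotient.out c)))) :=
    fun v => (mG v).isFiniteMeasureOnCompacts_atPoint _
  have hne : ∀ v, (mG v).atPoint ((cmDatum L N H).toLocal v ((cmDatum L N H).toAdelic (Quotient.out c))) ≠ 0 := fun v => (mG v).atPoint_ne_zero _ (hadm v).1
  have hex : ∃ S₀, IsNormalisedOff L N H mG ((cmDatum L N H).toAdelic (Quotient.out c)) S₀ := ⟨S₀, hS₀⟩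
  have hdef : AdelicOrbitalMeasureFamily.ofLocal L N H mG mGi c =
      adelicOrbitalMeasureOfLocal L N H ((cmDatum L N H).toAdelic (Quotient.out c)) (mGi.atPoint (archPart (↥(maximalRealSubfield L)) L (IsCMField.complexConj L) N H ((cmDatum L N H).toAdelic (Quotient.out c))))
        (fun v => (mG v).atPoint ((cmDatum L N H).toLocal v ((cmDatum L N H).toAdelic (Quotient.out c)))) hex.choose := by
    show @dite _ (∃ S₀, IsNormalisedOff L N H mG ((cmDatum L N H).toAdelic (Quotient.out c)) S₀) (Classical.dec _) _ _ = _
    rw [dif_pos hex]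
  rw [hdef]
  -- both exceptional sets give the finite-adelic measure at `S₀ ∪ hex.choose`
  have h1 := (finAdelicOrbitalMeasureOfLocal_spec L N H ((cmDatum L N H).toAdelic (Quotient.out c)) (fun v => (mG v).atPoint ((cmDatum L N H).toLocal v ((cmDatum L N H).toAdelic (Quotient.out c)))) hS₀
    (fun v _ => hne v)).2.2.2.1 (S₀ ∪ hex.choose) Finset.subset_union_left
  have h2 := (finAdelicOrbitalMeasureOfLocal_spec L N H ((cmDatum L N H).toAdelic (Quotient.out c)) (fun v => (mG v).atPoint ((cmDatum L N H).toLocal v ((cmDatum L N H).toAdelic (Quotient.out c)))) hex.choose_spec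
    (fun v _ => hne v)).2.2.2.1 (S₀ ∪ hex.choose) Finset.subset_union_right
  unfold adelicOrbitalMeasureOfLocal
  rw [← h2, h1]

variable [∀ g : (cmDatum L N H).Adelic, BorelSpace ((cmDatum L N H).Adelic ⧸ Subgroup.centralizer ({g} : Set (cmDatum L N H).Adelic))]
  [∀ a : arch (↥(maximalRealSubfield L)) L (IsCMField.complexConj L) N H,
    BorelSpace (arch (↥(maximalRealSubfield L)) L (IsCMField.complexConj L) N H ⧸
      Subgroup.centralizer ({a} : Set (arch (↥(maximalRealSubfield L)) L (IsCMField.complexConj L) N H)))]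

/-- **`ofLocal` is ADMISSIBLE at every class where the local data are admissible and normalised**: invariant, finite on compacta, non-zero.
[cite: Rogawski1990, §5.4 p. 72] -/
theorem AdelicOrbitalMeasureFamily.ofLocal_admissible {S₀ : Finset (HeightOneSpectrum (𝓞 ↥(maximalRealSubfield L)))}
    (hS₀ : IsNormalisedOff L N H mG ((cmDatum L N H).toAdelic (Quotient.out c)) S₀)
    (hadm : ∀ v, mG v (ConjClasses.mk ((cmDatum L N H).toLocal v ((cmDatum L N H).toAdelic (Quotient.out c)))) ≠ 0 ∧
      SMulInvariantMeasure ((cmDatum L N H).Local v) _ (mG v (ConjClasses.mk ((cmDatum L N H).toLocal v ((cmDatum L N H).toAdelic (Quotient.out c))))) ∧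
      IsFiniteMeasureOnCompacts (mG v (ConjClasses.mk ((cmDatum L N H).toLocal v ((cmDatum L N H).toAdelic (Quotient.out c))))))
    (hadmA : mGi (ConjClasses.mk (archPart (↥(maximalRealSubfield L)) L (IsCMField.complexConj L) N H ((cmDatum L N H).toAdelic (Quotient.out c)))) ≠ 0 ∧
      SMulInvariantMeasure (arch (↥(maximalRealSubfield L)) L (IsCMField.complexConj L) N H) _
        (mGi (ConjClasses.mk (archPart (↥(maximalRealSubfield L)) L (IsCMField.complexConj L) N H ((cmDatum L N H).toAdelic (Quotient.out c))))) ∧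
      IsFiniteMeasureOnCompacts (mGi (ConjClasses.mk (archPart (↥(maximalRealSubfield L)) L (IsCMField.complexConj L) N H ((cmDatum L N H).toAdelic (Quotient.out c)))))) :
    SMulInvariantMeasure (cmDatum L N H).Adelic _ (AdelicOrbitalMeasureFamily.ofLocal L N H mG mGi c) ∧
      IsFiniteMeasureOnCompacts (AdelicOrbitalMeasureFamily.ofLocal L N H mG mGi c) ∧
      AdelicOrbitalMeasureFamily.ofLocal L N H mG mGi c ≠ 0 := by
  letI : MeasurableSpace (finAdelic (↥(maximalRealSubfield L)) L (IsCMField.complexConj L) N H ⧸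
      Subgroup.centralizer ({finPart (↥(maximalRealSubfield L)) L (IsCMField.complexConj L) N H ((cmDatum L N H).toAdelic (Quotient.out c))} :
        Set (finAdelic (↥(maximalRealSubfield L)) L (IsCMField.complexConj L) N H))) := borel _
  haveI : BorelSpace (finAdelic (↥(maximalRealSubfield L)) L (IsCMField.complexConj L) N H ⧸
      Subgroup.centralizer ({finPart (↥(maximalRealSubfield L)) L (IsCMField.complexConj L) N H ((cmDatum L N H).toAdelic (Quotient.out c))} :
        Set (finAdelic (↥(maximalRealSubfield L)) L (IsCMField.complexConj L) N H))) := ⟨rfl⟩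
  haveI : ∀ v, SMulInvariantMeasure ((cmDatum L N H).Local v) _ (mG v (ConjClasses.mk ((cmDatum L N H).toLocal v ((cmDatum L N H).toAdelic (Quotient.out c))))) := fun v => (hadm v).2.1
  haveI : ∀ v, IsFiniteMeasureOnCompacts (mG v (ConjClasses.mk ((cmDatum L N H).toLocal v ((cmDatum L N H).toAdelic (Quotient.out c))))) := fun v => (hadm v).2.2
  haveI : ∀ v, SMulInvariantMeasure ((cmDatum L N H).Local v) _ ((mG v).atPoint ((cmDatum L N H).toLocal v ((cmDatum L N H).toAdelic (Quotient.out c)))) :=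
    fun v => (mG v).smulInvariantMeasure_atPoint _
  haveI : ∀ v, IsFiniteMeasureOnCompacts ((mG v).atPoint ((cmDatum L N H).toLocal v ((cmDatum L N H).toAdelic (Quotient.out c)))) :=
    fun v => (mG v).isFiniteMeasureOnCompacts_atPoint _
  haveI := hadmA.2.1
  haveI := hadmA.2.2
  haveI : SMulInvariantMeasure (arch (↥(maximalRealSubfield L)) L (IsCMField.complexConj L) N H) _
      (mGi.atPoint (archPart (↥(maximalRealSubfield L)) L (IsCMField.complexConj L) N H ((cmDatum L N H).toAdelic (Quotient.out c)))) := mGi.smulInvariantMeasure_atPoint _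
  haveI : IsFiniteMeasureOnCompacts (mGi.atPoint (archPart (↥(maximalRealSubfield L)) L (IsCMField.complexConj L) N H ((cmDatum L N H).toAdelic (Quotient.out c)))) :=
    mGi.isFiniteMeasureOnCompacts_atPoint _
  haveI : SFinite (mGi.atPoint (archPart (↥(maximalRealSubfield L)) L (IsCMField.complexConj L) N H ((cmDatum L N H).toAdelic (Quotient.out c)))) := by
    haveI : IsLocallyFiniteMeasure (mGi.atPoint (archPart (↥(maximalRealSubfield L)) L (IsCMField.complexConj L) N H ((cmDatum L N H).toAdelic (Quotient.out c)))) :=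
      isLocallyFiniteMeasure_of_isFiniteMeasureOnCompacts
    haveI : SigmaFinite (mGi.atPoint (archPart (↥(maximalRealSubfield L)) L (IsCMField.complexConj L) N H ((cmDatum L N H).toAdelic (Quotient.out c)))) := sigmaFinite_of_locallyFinite
    infer_instance
  have h := adelicOrbitalMeasureOfLocal_spec L N H ((cmDatum L N H).toAdelic (Quotient.out c)) (mGi.atPoint (archPart (↥(maximalRealSubfield L)) L (IsCMField.complexConj L) N H ((cmDatum L N H).toAdelic (Quotient.out c))))
    (fun v => (mG v).atPoint ((cmDatum L N H).toLocal v ((cmDatum L N H).toAdelic (Quotient.out c)))) (mGi.atPoint_ne_zero _ hadmA.1) hS₀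
    (fun v _ => (mG v).atPoint_ne_zero _ (hadm v).1)
  rw [AdelicOrbitalMeasureFamily.ofLocal_eq L N H mG mGi c hS₀ hadm]
  exact ⟨h.1, h.2.1, h.2.2.1⟩

/-- **THE EXACT EULER PRODUCT FOR `ofLocal` IN CLASS CURRENCY.**  At a rational class `c` (`γ = toAdelic (out c)`, `γ_v = toLocal v γ`,
`γ_∞ = archPart γ`) where the local families are admissible and normalised off `S₀`: for every pure tensor `T = f_∞ ⊗ ⊗_v f_v` with integral levels off
`T.S` whose orbital integrand at `γ` is integrable for `ofLocal mG mGi c` and whose local CLASS orbital integrals are `1` off a finite `S₂`,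
`adelicClassOrbitalIntegral (ofLocal mG mGi) T.eval c = classOrbitalIntegral mGi T.arch [γ_∞] · ∏_{v∈S₂} classOrbitalIntegral (mG v) (T.loc v) [γ_v]`
— `Φ(γ, f) = ∏_v Φ(γ_v, f_v)` [Rogawski1990, §5.4 p. 72] with NO constant, every factor the transfer relations' own. [cite: Rogawski1990, §5.4 p. 72]
[cite: Gelbart1975, p. 155 (10.19)] -/
theorem adelicClassOrbitalIntegral_ofLocal_eval_eq_mul_prod {S₀ : Finset (HeightOneSpectrum (𝓞 ↥(maximalRealSubfield L)))}
    (hS₀ : IsNormalisedOff L N H mG ((cmDatum L N H).toAdelic (Quotient.out c)) S₀)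
    (hadm : ∀ v, mG v (ConjClasses.mk ((cmDatum L N H).toLocal v ((cmDatum L N H).toAdelic (Quotient.out c)))) ≠ 0 ∧
      SMulInvariantMeasure ((cmDatum L N H).Local v) _ (mG v (ConjClasses.mk ((cmDatum L N H).toLocal v ((cmDatum L N H).toAdelic (Quotient.out c))))) ∧
      IsFiniteMeasureOnCompacts (mG v (ConjClasses.mk ((cmDatum L N H).toLocal v ((cmDatum L N H).toAdelic (Quotient.out c))))))
    (hadmA : mGi (ConjClasses.mk (archPart (↥(maximalRealSubfield L)) L (IsCMField.complexConj L) N H ((cmDatum L N H).toAdelic (Quotient.out c)))) ≠ 0 ∧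
      SMulInvariantMeasure (arch (↥(maximalRealSubfield L)) L (IsCMField.complexConj L) N H) _
        (mGi (ConjClasses.mk (archPart (↥(maximalRealSubfield L)) L (IsCMField.complexConj L) N H ((cmDatum L N H).toAdelic (Quotient.out c))))) ∧
      IsFiniteMeasureOnCompacts (mGi (ConjClasses.mk (archPart (↥(maximalRealSubfield L)) L (IsCMField.complexConj L) N H ((cmDatum L N H).toAdelic (Quotient.out c))))))
    (T : PureTensor L N H) (S₂ : Finset (HeightOneSpectrum (𝓞 ↥(maximalRealSubfield L))))
    (hK : ∀ v ∉ T.S, T.K v = cmLocalIntegralLevel L N H v)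
    (hFi : Integrable (descConj ((cmDatum L N H).toAdelic (Quotient.out c))
      (Subgroup.centralizer ({(cmDatum L N H).toAdelic (Quotient.out c)} : Set (cmDatum L N H).Adelic)) (centralizer_comm _) T.eval)
      (AdelicOrbitalMeasureFamily.ofLocal L N H mG mGi c))
    (hf1 : ∀ v, v ∉ S₂ → classOrbitalIntegral (mG v) (T.loc v)
      (ConjClasses.mk ((cmDatum L N H).toLocal v ((cmDatum L N H).toAdelic (Quotient.out c)))) = 1) :
    adelicClassOrbitalIntegral L N H (AdelicOrbitalMeasureFamily.ofLocal L N H mG mGi) T.eval c =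
      classOrbitalIntegral mGi T.arch
          (ConjClasses.mk (archPart (↥(maximalRealSubfield L)) L (IsCMField.complexConj L) N H ((cmDatum L N H).toAdelic (Quotient.out c)))) *
        ∏ v ∈ S₂, classOrbitalIntegral (mG v) (T.loc v) (ConjClasses.mk ((cmDatum L N H).toLocal v ((cmDatum L N H).toAdelic (Quotient.out c)))) := by
  letI : MeasurableSpace (finAdelic (↥(maximalRealSubfield L)) L (IsCMField.complexConj L) N H ⧸
      Subgroup.centralizer ({finPart (↥(maximalRealSubfield L)) L (IsCMField.complexConj L) N H ((cmDatum L N H).toAdelic (Quotient.out c))} :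
        Set (finAdelic (↥(maximalRealSubfield L)) L (IsCMField.complexConj L) N H))) := borel _
  haveI : BorelSpace (finAdelic (↥(maximalRealSubfield L)) L (IsCMField.complexConj L) N H ⧸
      Subgroup.centralizer ({finPart (↥(maximalRealSubfield L)) L (IsCMField.complexConj L) N H ((cmDatum L N H).toAdelic (Quotient.out c))} :
        Set (finAdelic (↥(maximalRealSubfield L)) L (IsCMField.complexConj L) N H))) := ⟨rfl⟩
  haveI : ∀ v, SMulInvariantMeasure ((cmDatum L N H).Local v) _ (mG v (ConjClasses.mk ((cmDatum L N H).toLocal v ((cmDatum L N H).toAdelic (Quotient.out c))))) := fun v => (hadm v).2.1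
  haveI : ∀ v, IsFiniteMeasureOnCompacts (mG v (ConjClasses.mk ((cmDatum L N H).toLocal v ((cmDatum L N H).toAdelic (Quotient.out c))))) := fun v => (hadm v).2.2
  haveI : ∀ v, SMulInvariantMeasure ((cmDatum L N H).Local v) _ ((mG v).atPoint ((cmDatum L N H).toLocal v ((cmDatum L N H).toAdelic (Quotient.out c)))) :=
    fun v => (mG v).smulInvariantMeasure_atPoint _
  haveI : ∀ v, IsFiniteMeasureOnCompacts ((mG v).atPoint ((cmDatum L N H).toLocal v ((cmDatum L N H).toAdelic (Quotient.out c)))) :=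
    fun v => (mG v).isFiniteMeasureOnCompacts_atPoint _
  haveI := hadmA.2.1
  haveI := hadmA.2.2
  haveI : SMulInvariantMeasure (arch (↥(maximalRealSubfield L)) L (IsCMField.complexConj L) N H) _
      (mGi.atPoint (archPart (↥(maximalRealSubfield L)) L (IsCMField.complexConj L) N H ((cmDatum L N H).toAdelic (Quotient.out c)))) := mGi.smulInvariantMeasure_atPoint _
  haveI : IsFiniteMeasureOnCompacts (mGi.atPoint (archPart (↥(maximalRealSubfield L)) L (IsCMField.complexConj L) N H ((cmDatum L N H).toAdelic (Quotient.out c)))) :=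
    mGi.isFiniteMeasureOnCompacts_atPoint _
  haveI : SFinite (mGi.atPoint (archPart (↥(maximalRealSubfield L)) L (IsCMField.complexConj L) N H ((cmDatum L N H).toAdelic (Quotient.out c)))) := by
    haveI : IsLocallyFiniteMeasure (mGi.atPoint (archPart (↥(maximalRealSubfield L)) L (IsCMField.complexConj L) N H ((cmDatum L N H).toAdelic (Quotient.out c)))) :=
      isLocallyFiniteMeasure_of_isFiniteMeasureOnCompacts
    haveI : SigmaFinite (mGi.atPoint (archPart (↥(maximalRealSubfield L)) L (IsCMField.complexConj L) N H ((cmDatum L N H).toAdelic (Quotient.out c)))) := sigmaFinite_of_locallyFinite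
    infer_instance
  have heq := AdelicOrbitalMeasureFamily.ofLocal_eq L N H mG mGi c hS₀ hadm
  rw [heq] at hFi
  change orbitalIntegral ((cmDatum L N H).toAdelic (Quotient.out c)) T.eval (AdelicOrbitalMeasureFamily.ofLocal L N H mG mGi c) = _
  rw [heq,
    orbitalIntegral_eval_adelicOrbitalMeasureOfLocal_eq_mul_prod' L N H ((cmDatum L N H).toAdelic (Quotient.out c))
      (mGi.atPoint (archPart (↥(maximalRealSubfield L)) L (IsCMField.complexConj L) N H ((cmDatum L N H).toAdelic (Quotient.out c))))
      (fun v => (mG v).atPoint ((cmDatum L N H).toLocal v ((cmDatum L N H).toAdelic (Quotient.out c)))) (mGi.atPoint_ne_zero _ hadmA.1) hS₀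
      (fun v _ => (mG v).atPoint_ne_zero _ (hadm v).1) T S₂ hK hFi
      (fun v hv => by rw [localOrbitalIntegral, (mG v).orbitalIntegral_atPoint]; exact hf1 v hv),
    mGi.orbitalIntegral_atPoint]
  exact congrArg _ (Finset.prod_congr rfl fun v _ => (mG v).orbitalIntegral_atPoint _ _)

end UnitaryGroup

end Literature.NumberTheory.Automorphic

end
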